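import Mathlib.Topology.ContinuousMap.Bounded.ArzelaAscoli
import Mathlib.Analysis.Calculus.UniformLimitsDeriv
import Mathlib.Analysis.Calculus.MeanValue
import Mathlib.LinearAlgebra.Multilinear.FiniteDimensional
import Literature.Analysis.FunctionSpaces.ContDiffHolderSpace
import Literature.Analysis.FunctionSpaces.HolderAlgebra
import HarnessLib

/-!
# Arzelà–Ascoli in `C^{k,r}_b`: bounded sequences with uniformly compact support (Hölder spaces, part 17)

Topic `Literature/Analysis/FunctionSpaces`. On finite-dimensional `E`, `F`, a sequence in
`C^{k,r}_b(E, F)` (`0 < r`) that is bounded in norm and supported in a fixed compact set `K` has a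
subsequence all of whose derivatives of order `≤ k` converge uniformly, and the limit lies in
`C^{k,r}_b(E, F)` with support in `K` (`exists_subseq_tendstoUniformly_of_norm_le`). This is the
compactness of the embedding `C^{k,α} ↪ C^k` on compact sets (Gilbarg–Trudinger 2001, Lemma 6.36
via Arzelà–Ascoli): the derivatives `Dʲfₙ`, `j ≤ k`, are uniformly bounded and uniformly
equicontinuous (Lipschitz with constant `‖f‖` for `j < k` by the mean value theorem, `r`-Hölder with
constant `‖f‖` for `j = k`), so Mathlib's `BoundedContinuousFunction.arzela_ascoli` applies to the
jets `x ↦ (Dʲfₙ(x))_{j ≤ k}` on the compact set `K`; the limit is identified by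
`contDiff_and_iteratedFDeriv_eq_of_tendstoUniformly` (uniform limits of all derivatives,
`hasFDerivAt_of_tendstoUniformly`). Everything is proved; no named facts. Needed for the surjectivity
half of census item (2c) of `Literature.Geometry.Riemannian.gurskyViaclovsky_pathOpen_weighted_four`
(solutions with smooth data converge to a `C^{2,α}` solution) and for Evans–Krylov-type compactness.

## References

* D. Gilbarg, N. S. Trudinger, *Elliptic Partial Differential Equations of Second Order* (2001),
  Lemma 6.36. [GilbargTrudinger2001]
-/

noncomputable section

open Set Filter Topology Function Metric BoundedContinuousFunction
open scoped NNReal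

namespace Literature.Analysis.FunctionSpaces

/-! ### Uniform limits of all derivatives -/

section Limit

variable {E F : Type*} [NormedAddCommGroup E] [NormedSpace ℝ E] [NormedAddCommGroup F]
  [NormedSpace ℝ F] {k : ℕ}

/-- **Uniform limits of all derivatives**: if `uₙ ∈ C^k` and `Dʲuₙ → Gⱼ` uniformly for every
`j ≤ k`, then `g = G₀` (uncurried) is `C^k` with `Dʲg = Gⱼ` for `j ≤ k`. [folklore] -/
theorem contDiff_and_iteratedFDeriv_eq_of_tendstoUniformly {u : ℕ → E → F}
    (hu : ∀ n, ContDiff ℝ k (u n)) {G : (j : ℕ) → E → E [×j]→L[ℝ] F}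
    (hunif : ∀ j : ℕ, j ≤ k → TendstoUniformly (fun n => iteratedFDeriv ℝ j (u n)) (G j) atTop) :
    ContDiff ℝ k (fun x => continuousMultilinearCurryFin0 ℝ E F (G 0 x)) ∧
      ∀ j : ℕ, j ≤ k →
        iteratedFDeriv ℝ j (fun x => continuousMultilinearCurryFin0 ℝ E F (G 0 x)) = G j := by
  have hG : ∀ j : ℕ, j ≤ k → ∀ x, Tendsto (fun n => iteratedFDeriv ℝ j (u n) x) atTop (𝓝 (G j x)) :=
    fun j hj x => (hunif j hj).tendsto_at x
  set g : E → F := fun x => continuousMultilinearCurryFin0 ℝ E F (G 0 x) with hgdef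
  have hstep : ∀ j : ℕ, j + 1 ≤ k → iteratedFDeriv ℝ j g = G j →
      ∀ x, HasFDerivAt (iteratedFDeriv ℝ j g)
        (continuousMultilinearCurryLeftEquiv ℝ (fun _ : Fin (j + 1) => E) F (G (j + 1) x)) x := by
    intro j hj heq
    have hj' : j ≤ k := (Nat.le_succ j).trans hj
    have hf' : TendstoUniformly (fun n => fderiv ℝ (iteratedFDeriv ℝ j (u n)))
        (fun x => continuousMultilinearCurryLeftEquiv ℝ (fun _ : Fin (j + 1) => E) F (G (j + 1) x))
        atTop := by
      refine (Metric.tendstoUniformly_iff (α := E →L[ℝ] (E [×j]→L[ℝ] F))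
        (F := fun n => fderiv ℝ (iteratedFDeriv ℝ j (u n)))
        (f := fun x => continuousMultilinearCurryLeftEquiv ℝ (fun _ : Fin (j + 1) => E) F
          (G (j + 1) x)) (p := atTop)).2 fun ε hε => ?_
      filter_upwards [Metric.tendstoUniformly_iff.1 (hunif (j + 1) hj) ε hε] with n hn x
      rw [fderiv_iteratedFDeriv, Function.comp_apply, LinearIsometryEquiv.dist_map]
      exact hn x
    have hf : ∀ n x, HasFDerivAt (iteratedFDeriv ℝ j (u n))
        (fderiv ℝ (iteratedFDeriv ℝ j (u n)) x) x := fun n x =>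
      (((hu n).differentiable_iteratedFDeriv (by exact_mod_cast hj)) x).hasFDerivAt
    have hfg : ∀ x, Tendsto (fun n => iteratedFDeriv ℝ j (u n) x) atTop
        (𝓝 (iteratedFDeriv ℝ j g x)) := fun x => by
      rw [heq]
      exact hG j hj' x
    exact hasFDerivAt_of_tendstoUniformly hf' hf hfg
  have hDg : ∀ j : ℕ, j ≤ k → iteratedFDeriv ℝ j g = G j := by
    intro j
    induction j with
    | zero =>
      intro _
      funext x
      rw [iteratedFDeriv_zero_eq_comp, Function.comp_apply]
      exact (continuousMultilinearCurryFin0 ℝ E F).symm_apply_apply (G 0 x)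
    | succ j ih =>
      intro hj
      have heq := ih ((Nat.le_succ j).trans hj)
      funext x
      rw [iteratedFDeriv_succ_eq_comp_left, Function.comp_apply, (hstep j hj heq x).fderiv]
      exact (continuousMultilinearCurryLeftEquiv ℝ (fun _ : Fin (j + 1) => E) F).symm_apply_apply _
  have hgk : ContDiff ℝ k g := by
    refine contDiff_nat_iff_continuous_differentiable.2 ⟨fun m hm => ?_, fun m hm => ?_⟩
    · rw [show (fun x => iteratedFDeriv ℝ m g x) = G m from hDg m hm]
      exact (hunif m hm).continuous (Eventually.of_forall fun n =>
        (hu n).continuous_iteratedFDeriv (by exact_mod_cast hm)).frequently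
    · exact fun x => (hstep m hm (hDg m hm.le) x).differentiableAt
  exact ⟨hgk, hDg⟩

end Limit

/-! ### Equicontinuity of bounded families -/

section Equi

variable {E F : Type*} [NormedAddCommGroup E] [NormedSpace ℝ E] [NormedAddCommGroup F]
  [NormedSpace ℝ F] {k : ℕ} {r : ℝ≥0}

/-- **Lower derivatives of a member are Lipschitz with constant `‖f‖`** (`j < k`, mean value
theorem with `‖Dʲ⁺¹f‖ ≤ ‖f‖`). [folklore] -/
theorem norm_iteratedFDeriv_sub_le_norm_mul (f : ContDiffHolderFunction E F k r) {j : ℕ}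
    (hj : j + 1 ≤ k) (x y : E) :
    ‖iteratedFDeriv ℝ j (f : E → F) x - iteratedFDeriv ℝ j (f : E → F) y‖ ≤ ‖f‖ * ‖x - y‖ := by
  have hdiff : ∀ z ∈ (univ : Set E), DifferentiableAt ℝ (iteratedFDeriv ℝ j (f : E → F)) z :=
    fun z _ => (f.contDiff.differentiable_iteratedFDeriv (by exact_mod_cast hj)) z
  have hbound : ∀ z ∈ (univ : Set E), ‖fderiv ℝ (iteratedFDeriv ℝ j (f : E → F)) z‖ ≤ ‖f‖ := by
    intro z _
    rw [norm_fderiv_iteratedFDeriv]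
    exact f.norm_iteratedFDeriv_le_norm hj z
  exact convex_univ.norm_image_sub_le_of_norm_fderiv_le hdiff hbound (mem_univ y) (mem_univ x)

/-- **The top derivative of a member is `r`-Hölder with constant `‖f‖`.** [folklore] -/
theorem norm_iteratedFDeriv_top_sub_le (f : ContDiffHolderFunction E F k r) (x y : E) :
    ‖iteratedFDeriv ℝ k (f : E → F) x - iteratedFDeriv ℝ k (f : E → F) y‖ ≤ ‖f‖ * ‖x - y‖ ^ (r : ℝ) := by
  have h := f.memHolder.holderWith.dist_le x y
  rw [dist_eq_norm, dist_eq_norm] at h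
  exact h.trans (mul_le_mul_of_nonneg_right f.nnHolderNorm_le_norm (by positivity))

end Equi

/-! ### Arzelà–Ascoli -/

section AA

variable {E F : Type*} [NormedAddCommGroup E] [NormedSpace ℝ E] [FiniteDimensional ℝ E]
  [NormedAddCommGroup F] [NormedSpace ℝ F] [FiniteDimensional ℝ F] {k : ℕ} {r : ℝ≥0}

/-- Continuous multilinear maps between finite-dimensional spaces form a finite-dimensional space
(all multilinear maps are continuous). [folklore] -/
instance instFiniteDimensionalContinuousMultilinearMap (j : ℕ) :
    FiniteDimensional ℝ (E [×j]→L[ℝ] F) :=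
  Module.Finite.of_injective
    (ContinuousMultilinearMap.toMultilinearMapLinear (R' := ℝ) (A := ℝ)
      (M₁ := fun _ : Fin j => E) (M₂ := F))
    ContinuousMultilinearMap.toMultilinearMap_injective

/-- **Arzelà–Ascoli in `C^{k,r}_b`**: a norm-bounded sequence in `C^{k,r}_b(E, F)` (`E`, `F`
finite-dimensional, `0 < r`) supported in a fixed compact set `K` has a subsequence whose
derivatives of all orders `≤ k` converge uniformly on `E`; the limit is in `C^{k,r}_b(E, F)` and is
supported in `K`. [cite: GilbargTrudinger2001, Lemma 6.36] -/
theorem exists_subseq_tendstoUniformly_of_norm_le (hr : 0 < r) {K : Set E} (hK : IsCompact K)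
    (f : ℕ → ContDiffHolderFunction E F k r) {B : ℝ} (hB : ∀ n, ‖f n‖ ≤ B)
    (hsupp : ∀ n, tsupport (f n : E → F) ⊆ K) :
    ∃ φ : ℕ → ℕ, StrictMono φ ∧ ∃ g : ContDiffHolderFunction E F k r, tsupport (g : E → F) ⊆ K ∧
      ∀ j : ℕ, j ≤ k → TendstoUniformly (fun n => iteratedFDeriv ℝ j (f (φ n) : E → F))
        (iteratedFDeriv ℝ j (g : E → F)) atTop := by
  classical
  haveI : CompactSpace K := isCompact_iff_compactSpace.1 hK
  have hB0 : 0 ≤ B := (norm_nonneg _).trans (hB 0)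
  -- the jets on `K`, as bounded continuous functions into a finite-dimensional space
  let β := (j : Fin (k + 1)) → (E [×(j : ℕ)]→L[ℝ] F)
  have hcont : ∀ (n : ℕ) (j : Fin (k + 1)),
      Continuous fun x : K => iteratedFDeriv ℝ (j : ℕ) (f n : E → F) x := fun n j =>
    ((f n).continuous_iteratedFDeriv (Nat.lt_succ_iff.1 j.2)).comp continuous_subtype_val
  let Φ : ℕ → K →ᵇ β := fun n =>
    BoundedContinuousFunction.mkOfCompact
      ⟨fun x j => iteratedFDeriv ℝ (j : ℕ) (f n : E → F) x,
        continuous_pi fun j => hcont n j⟩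
  have hΦ : ∀ n (x : K) (j : Fin (k + 1)), Φ n x j = iteratedFDeriv ℝ (j : ℕ) (f n : E → F) x :=
    fun n x j => rfl
  -- values in a compact ball
  have hin : ∀ (φ : K →ᵇ β) (x : K), φ ∈ range Φ → φ x ∈ closedBall (0 : β) B := by
    rintro _ x ⟨n, rfl⟩
    rw [mem_closedBall, dist_zero_right, pi_norm_le_iff_of_nonneg hB0]
    intro j
    rw [hΦ]
    exact ((f n).norm_iteratedFDeriv_le_norm (Nat.lt_succ_iff.1 j.2) _).trans (hB n)
  -- equicontinuity
  have hs0 : 0 < min (r : ℝ) 1 := lt_min (by exact_mod_cast hr) one_pos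
  have hmod : ∀ (n : ℕ) (j : Fin (k + 1)) (x y : E), ‖x - y‖ ≤ 1 →
      ‖iteratedFDeriv ℝ (j : ℕ) (f n : E → F) x - iteratedFDeriv ℝ (j : ℕ) (f n : E → F) y‖ ≤
        B * ‖x - y‖ ^ min (r : ℝ) 1 := by
    intro n j x y hxy
    have hj : (j : ℕ) ≤ k := Nat.lt_succ_iff.1 j.2
    rcases hj.lt_or_eq with hlt | heq
    · calc ‖iteratedFDeriv ℝ (j : ℕ) (f n : E → F) x - iteratedFDeriv ℝ (j : ℕ) (f n : E → F) y‖
          ≤ ‖f n‖ * ‖x - y‖ := norm_iteratedFDeriv_sub_le_norm_mul (f n) hlt x y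
        _ ≤ B * ‖x - y‖ ^ min (r : ℝ) 1 :=
          mul_le_mul (hB n) (Real.self_le_rpow_of_le_one (norm_nonneg _) hxy (min_le_right _ _))
            (norm_nonneg _) hB0
    · have heq' : (j : ℕ) = k := heq
      rw [heq']
      calc ‖iteratedFDeriv ℝ k (f n : E → F) x - iteratedFDeriv ℝ k (f n : E → F) y‖
          ≤ ‖f n‖ * ‖x - y‖ ^ (r : ℝ) := norm_iteratedFDeriv_top_sub_le (f n) x y
        _ ≤ B * ‖x - y‖ ^ min (r : ℝ) 1 := by
          refine mul_le_mul (hB n) ?_ (by positivity) hB0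
          rcases (norm_nonneg (x - y)).lt_or_eq with hpos | h0
          · exact Real.rpow_le_rpow_of_exponent_ge hpos hxy (min_le_left _ _)
          · rw [← h0, Real.zero_rpow (by exact_mod_cast hr.ne'), Real.zero_rpow hs0.ne']
  have hequi : Equicontinuous ((↑) : range Φ → K → β) := by
    intro x₀
    rw [Metric.equicontinuousAt_iff]
    intro ε hε
    -- `δ ∈ (0,1)` with `(B+1) δ^s < ε`, `s = min r 1`
    have hT : Tendsto (fun δ : ℝ => (B + 1) * δ ^ min (r : ℝ) 1) (𝓝[>] 0) (𝓝 0) := by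
      have hc : ContinuousAt (fun δ : ℝ => (B + 1) * δ ^ min (r : ℝ) 1) 0 :=
        continuousAt_const.mul (Real.continuousAt_rpow_const 0 _ (Or.inr hs0.le))
      have h0 : (B + 1) * (0 : ℝ) ^ min (r : ℝ) 1 = 0 := by rw [Real.zero_rpow hs0.ne', mul_zero]
      simpa [h0] using hc.tendsto.mono_left nhdsWithin_le_nhds
    obtain ⟨δ, ⟨hδε, hδ1⟩, hδ0⟩ := ((hT.eventually (gt_mem_nhds hε)).and
      (Ioo_mem_nhdsGT one_pos) |>.and self_mem_nhdsWithin).exists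
    refine ⟨δ, hδ0, fun x hx φ' => ?_⟩
    obtain ⟨_, n, rfl⟩ := φ'
    change dist (Φ n x₀) (Φ n x) < ε
    rw [dist_pi_lt_iff hε]
    intro j
    rw [hΦ, hΦ, dist_eq_norm]
    have hxx : ‖(x₀ : E) - x‖ < δ := by rw [← dist_eq_norm]; rw [dist_comm] at hx; exact hx
    have hxx1 : ‖(x₀ : E) - x‖ ≤ 1 := (hxx.trans hδ1.2).le
    calc ‖iteratedFDeriv ℝ (j : ℕ) (f n : E → F) x₀ - iteratedFDeriv ℝ (j : ℕ) (f n : E → F) x‖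
        ≤ B * ‖(x₀ : E) - x‖ ^ min (r : ℝ) 1 := hmod n j x₀ x hxx1
      _ ≤ (B + 1) * ‖(x₀ : E) - x‖ ^ min (r : ℝ) 1 :=
        mul_le_mul_of_nonneg_right (by linarith) (by positivity)
      _ ≤ (B + 1) * δ ^ min (r : ℝ) 1 := by
        refine mul_le_mul_of_nonneg_left ?_ (by linarith)
        exact Real.rpow_le_rpow (norm_nonneg _) hxx.le hs0.le
      _ < ε := hδε
  -- Arzelà–Ascoli and a convergent subsequence of jets on `K`
  have hcomp : IsCompact (closure (range Φ)) :=
    BoundedContinuousFunction.arzela_ascoli (closedBall (0 : β) B) (isCompact_closedBall 0 B)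
      (range Φ) hin hequi
  obtain ⟨Ψ, -, φ, hφ, hlim⟩ :=
    hcomp.tendsto_subseq fun n => subset_closure (mem_range_self (f := Φ) n)
  have hunifK : TendstoUniformly (fun n x => Φ (φ n) x) Ψ atTop :=
    BoundedContinuousFunction.tendsto_iff_tendstoUniformly.1 hlim
  -- the limits of the derivatives on `E` (zero off `K`)
  let G : (j : ℕ) → E → E [×j]→L[ℝ] F := fun j x =>
    if hx : x ∈ K then (if hj : j ≤ k then Ψ ⟨x, hx⟩ ⟨j, Nat.lt_succ_of_le hj⟩ else 0) else 0
  have hzero : ∀ (n j : ℕ) (x : E), x ∉ K → iteratedFDeriv ℝ j (f n : E → F) x = 0 := by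
    intro n j x hx
    by_contra h
    exact hx (hsupp n (support_iteratedFDeriv_subset j (mem_support.2 h)))
  have hunif : ∀ j : ℕ, j ≤ k →
      TendstoUniformly (fun n => iteratedFDeriv ℝ j (f (φ n) : E → F)) (G j) atTop := by
    intro j hj
    rw [Metric.tendstoUniformly_iff]
    intro ε hε
    filter_upwards [Metric.tendstoUniformly_iff.1 hunifK ε hε] with n hn x
    by_cases hx : x ∈ K
    · have h1 := hn ⟨x, hx⟩
      have h2 := dist_le_pi_dist (Ψ ⟨x, hx⟩) (Φ (φ n) ⟨x, hx⟩) ⟨j, Nat.lt_succ_of_le hj⟩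
      simp only [G, dif_pos hx, dif_pos hj]
      exact h2.trans_lt h1
    · simp only [G, dif_neg hx, hzero (φ n) j x hx, dist_self]
      exact hε
  -- the limit function
  obtain ⟨hgk, hDg⟩ := contDiff_and_iteratedFDeriv_eq_of_tendstoUniformly
    (fun n => (f (φ n)).contDiff) hunif
  set g : E → F := fun x => continuousMultilinearCurryFin0 ℝ E F (G 0 x) with hgdef
  -- bounds pass to the limit
  have hGbound : ∀ j : ℕ, j ≤ k → ∀ x, ‖G j x‖ ≤ B := fun j hj x =>
    le_of_tendsto ((hunif j hj).tendsto_at x).norm (Eventually.of_forall fun n =>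
      ((f (φ n)).norm_iteratedFDeriv_le_norm hj x).trans (hB _))
  have hGholder : HolderWith ⟨B, hB0⟩ r (G k) := by
    refine holderWith_of_dist_le fun x y => ?_
    refine le_of_tendsto (((hunif k le_rfl).tendsto_at x).dist ((hunif k le_rfl).tendsto_at y))
      (Eventually.of_forall fun n => ?_)
    rw [dist_eq_norm, dist_eq_norm]
    exact (norm_iteratedFDeriv_top_sub_le (f (φ n)) x y).trans
      (mul_le_mul_of_nonneg_right (hB _) (by positivity))
  have hgmem : MemContDiffHolder k r g := by
    refine ⟨hgk, fun j hj => ?_, ?_⟩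
    · rw [hDg j hj]
      exact eSupNorm_lt_top_iff.2 ⟨B, hGbound j hj⟩
    · rw [hDg k le_rfl]
      exact hGholder.memHolder
  have hgsupp : tsupport g ⊆ K := by
    refine closure_minimal (fun x hx => ?_) hK.isClosed
    by_contra hxK
    apply hx
    simp only [hgdef, G, dif_neg hxK]
    simp
  refine ⟨φ, hφ, ⟨g, hgmem⟩, hgsupp, fun j hj => ?_⟩
  have hDg' : iteratedFDeriv ℝ j ((⟨g, hgmem⟩ : ContDiffHolderFunction E F k r) : E → F) = G j :=
    hDg j hj
  rw [hDg']
  exact hunif j hj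

end AA

end Literature.Analysis.FunctionSpaces

end
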